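import Literature.MathematicalPhysics.QuantumFieldTheory.Balaban1983to89.B9Thm311CoercivePureGaugeAtLettersY
import Literature.MathematicalPhysics.QuantumFieldTheory.Balaban1983to89.B9Thm311InputsAtOne
import Literature.MathematicalPhysics.QuantumFieldTheory.Balaban1983to89.B6SectADeltaACoerciveOneLevelV1

/-!
# `Balaban1983to89.B9DeltaAOneCoerciveOneLevelY` — [B9] p. 395 «Δ_a(U) … coincides with Δ_a in (2.19) if U = 1» ∕ [4] p. 226 «the operator Δ_a is
# bounded from below by a positive constant»: ★★★ the flat operator `Δ_a(1)` of def-Y's letters is COERCIVE WITH AN EXPLICIT VOLUME-FREE CONSTANT on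
# every ONE-LEVEL (top-torus) member, in print's trace currency — ROAD «C» (dag-n10-c C1–C5) transferred to the N06 rows' letters (the W0 half, (a))

T. Bałaban, *Propagators for lattice gauge theories in a background field*, Commun. Math. Phys. **99** (1985) 389–434
[`Balaban1985BackgroundPropagators`, "B9"]; [4] = T. Bałaban, *Propagators and renormalization transformations for lattice gauge theories. II*,
Commun. Math. Phys. **96** (1984) 223–250 [`Balaban1984PropagatorsII`]; [Balaban1984PropagatorsI] Prop. 1.1 (1.90) p. 33.
Statement-level skeleton with citation tags; proofs where landed; nothing here is a claim about the Yang–Mills mass gap.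

THE PRINT (verbatim).  [B9] p. 395: *«Δ_a(U) = Δ(U) + D_U R(U) D*_U + Q*(U)aQ(U) (3.26) … It coincides with Δ_a in (2.19) of [4] if U = 1»*; p. 396 (3.34):
*«Δ_a(U^u) = R(u)Δ_a(U)R(u⁻¹)»*; [4] p. 226: *«One of our main results will be that the operator Δ_a is bounded from below by a positive constant»*;
[Balaban1984PropagatorsI] p. 33 (1.90): *«Δ_a = G⁻¹ ≥ γ₀(Δ + I) … with a positive constant γ₀ independent of k, T_η»*.

WHY THIS FILE (cell context, 2026-08-28).  Row 17 of the N06 knit displays «Δ_a(U) positive definite on (3.35)» (`hΔA`); the tree had it at `U = 1` and on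
the pure-gauge orbit QUALITATIVELY (`B9Thm311PosAtRecordV4.posDefTr_deltaAY_parSymY_one`, `B9Thm311CoercivePureGaugeAtLettersY.exists_coer_deltaAY_parSymY_one`:
`∃ γ > 0` per member, by finite-dimensional compactness).  dag-n10-c's ROAD «C» (stations C1–C5, 2026-08-28) PROVED [4]'s lower bound for r03∕p21's V1 operator
`deltaAE D c w` on every ONE-LEVEL nested family with an EXPLICIT constant `γ(d, L, k, c, w₀)` free of the volume, and typed the W0 socket
`B6SectADeltaACoerciveOneLevelV1.deltaAE_coercive_domT_of_lev_eq` at def-Y's domain datum `domT`.  THIS FILE is the W0 transfer (a) the lane assigned to this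
seat (bus I.40379, HANDOFF §g17 (t-W0)): through def-Y's identification `Node00.OpsYDeltaA.deltaAY_one` (`Δ_a(1) = liftEndY (onFun (deltaAE (domT …) c_f w))`) and
the ENTRYWISE reading of the trace pairing against a lifted real operator (`B9Thm311InputsAtOne.trIP_one_liftOpY_eq`, made quantitative in §1), the V1
coercivity becomes, verbatim in the currency of the rows (`trIP (fun _ => 1)` on `M_N(ℂ)`-valued bond functions):
  ★★★ `coer_trIP_deltaAY_parSymY_one_of_lev_eq`:  `γ · ⟨Ψ, Ψ⟩₁ ≤ ⟨Ψ, Δ_a(1) Ψ⟩₁`  for EVERY `Ψ : FBondY i → M_N(ℂ)`, at every index `i` whose torus family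
  has constant level (`∀ x, i.D.lev x = i.k` — the top-torus members «Ω_j = T_η»), `γ` = C5's constant at `(c := i.cf, k := i.k, w₀)`;
  ★★ `coer_trIP_deltaAY_parSymY_pureGauge_of_lev_eq`: the SAME `γ` on the whole orbit `U = 1^u`, `u` unitary-valued ((3.34): `deltaAY_cov` + `coer_of_intw_conjY`);
  `w_lower_of_globalBand`: the index's weight band (`KIdx.hwb`) gives the floor `w₀ := b₀·c_f²` when `0 ≤ b₀`, so ★★ `coer_trIP_deltaAY_parSymY_one_of_lev_eq_band` needs
  no weight hypothesis beyond `0 < b₀`.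
§1 is generic and reusable by the LOCAL edition (W0 (b)): `liftOpY_coer`, `liftEndY_coer` (a real quadratic-form lower bound lifts to the trace currency with the
same constant), `trIP_one_self_eq`, `onFun_coer_of_inner`.

HONEST SCOPE.  Composition of landed kernel theorems (n10-c C1–C5, def-Y `deltaAY_one`, this seat's g6∕g13 lift ∕ transport lemmas); ONE-LEVEL members only (the
multi-level interfaces are print's Sect. C two-scale machinery = ROAD «C» station C6, not here); the constant is n10-c's (explicit, volume-free, k-DEPENDENT —
print's γ₀ of (1.90) is k-uniform in its η-units; no such uniformity is claimed); NOT a node discharge; count-neutral; one finite 𝕋⁴ programme — nothing continuum,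
nothing about the mass gap.  Cell `pub-ymgap` (D-0062), node N06 [B9] × N10 ROAD «C», seat `pub-ymgap-dag-n06-j` gen 24, 2026-08-28.  No `sorry`∕`axiom`∕`def`.
-/

namespace Literature.MathematicalPhysics.QuantumFieldTheory.Balaban1983to89.B9DeltaAOneCoerciveOneLevelY

open Literature.MathematicalPhysics.QuantumFieldTheory.Balaban1983to89
open B9Thm311ReadingCoords B9Thm311InputsAtOne B9Thm311PosAtRecordV4 B9Thm311DeltaAGaugeOrbit B9Thm311CoercivePureGaugeAtLettersY Node00
open B6KLevelCensusIndexV1 B6GlobalChartV1 B6Ineq2133TwoScaleV1 B6SectAOperatorsV1 B6SectAVectorModelV1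
open Literature.MathematicalPhysics.QuantumFieldTheory.Balaban1983to89.B6SectADeltaACoerciveOneLevelV1
  (deltaAE_coercive_domT_of_lev_eq deltaAE_coercive_const_pos)
open scoped Matrix InnerProductSpace

noncomputable section

/-! ## §1 Quantitative lifts: a real quadratic-form lower bound passes to the trace currency with the same constant -/

section Lift

open scoped Matrix.Norms.L2Operator

variable {N : ℕ} {X : Type} [Fintype X]

/-- the lift of the identity matrix is the identity. [folklore] -/
private theorem liftOpY_one_apply [DecidableEq X] (Φ : X → Matrix (Fin N) (Fin N) ℂ) :
    liftOpY (Matrix (Fin N) (Fin N) ℂ) (1 : Matrix X X ℝ) Φ = Φ := by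
  funext z
  change ∑ w, (((1 : Matrix X X ℝ) z w : ℝ) : ℂ) • Φ w = Φ z
  rw [Finset.sum_eq_single z]
  · simp
  · intro w _ hw
    rw [Matrix.one_apply_ne' hw]; simp
  · intro h; exact absurd (Finset.mem_univ z) h

/-- **the weight-1 trace norm in real coordinates**: `⟨Φ,Φ⟩₁ = Σ_{a,b,c} v_{abc}·v_{abc}`, `v_{abc}(z) = (Re ∕ Im) Φ(z)_{ab}`.
[cite: Balaban1985BackgroundPropagators, p.393 (scalar products); Balaban1984PropagatorsII, (2.69) p.235, bookkeeping] -/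
theorem trIP_one_self_eq [DecidableEq X] (Φ : X → Matrix (Fin N) (Fin N) ℂ) :
    trIP (fun _ => (1 : ℝ)) Φ Φ = ∑ a : Fin N, ∑ b : Fin N, ∑ c : Fin 2, (fun z => cpart c (Φ z a b)) ⬝ᵥ (fun z => cpart c (Φ z a b)) := by
  have h := trIP_one_liftOpY_eq (1 : Matrix X X ℝ) Φ
  rw [liftOpY_one_apply] at h
  simpa only [Matrix.one_mulVec] using h

/-- ★ **QUANTITATIVE LIFT (matrix form)**: if `γ·(v·v) ≤ v·(Mv)` for every real `v`, then `γ·⟨Φ,Φ⟩₁ ≤ ⟨Φ, M♯Φ⟩₁` for every `M_N(ℂ)`-valued `Φ` — the entrywise reading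
`trIP_one_liftOpY_eq` summed against the coordinate form of `⟨Φ,Φ⟩₁`. [cite: Balaban1984PropagatorsII, (2.14) p.225 + p.226 («bounded from below by a positive constant»), bookkeeping] -/
theorem liftOpY_coer [DecidableEq X] (M : Matrix X X ℝ) {γ : ℝ} (hM : ∀ v : X → ℝ, γ * (v ⬝ᵥ v) ≤ v ⬝ᵥ M *ᵥ v)
    (Φ : X → Matrix (Fin N) (Fin N) ℂ) :
    γ * trIP (fun _ => (1 : ℝ)) Φ Φ ≤ trIP (fun _ => (1 : ℝ)) Φ (liftOpY (Matrix (Fin N) (Fin N) ℂ) M Φ) := by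
  rw [trIP_one_liftOpY_eq, trIP_one_self_eq, Finset.mul_sum]
  refine Finset.sum_le_sum fun a _ => ?_
  rw [Finset.mul_sum]
  refine Finset.sum_le_sum fun b _ => ?_
  rw [Finset.mul_sum]
  exact Finset.sum_le_sum fun c _ => hM _

/-- ★ **QUANTITATIVE LIFT (endomorphism form)**: `γ·(v·v) ≤ v·(Tv)` for every real `v` ⟹ `γ·⟨Φ,Φ⟩₁ ≤ ⟨Φ, (liftEndY T)Φ⟩₁` for every `Φ`.
[cite: Balaban1984PropagatorsII, p.226 («bounded from below by a positive constant»); Balaban1985BackgroundPropagators, p.395 («if U = 1»), bookkeeping] -/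
theorem liftEndY_coer [DecidableEq X] (T : Module.End ℝ (X → ℝ)) {γ : ℝ} (hT : ∀ v : X → ℝ, γ * (v ⬝ᵥ v) ≤ v ⬝ᵥ T v)
    (Φ : X → Matrix (Fin N) (Fin N) ℂ) :
    γ * trIP (fun _ => (1 : ℝ)) Φ Φ ≤ trIP (fun _ => (1 : ℝ)) Φ (liftEndY (Matrix (Fin N) (Fin N) ℂ) T Φ) :=
  liftOpY_coer _ (fun v => by rw [LinearMap.toMatrix'_mulVec]; exact hT v) Φ

/-- the dot square is the Euclidean norm square of the `ℓ²` reading. [folklore] -/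
private theorem dotProduct_self_eq_norm_sq (v : X → ℝ) : v ⬝ᵥ v = ‖WithLp.toLp 2 v‖ ^ 2 := by
  rw [← real_inner_self_eq_norm_sq, EuclideanSpace.inner_toLp_toLp, star_trivial]

/-- **an `ℓ²` coercivity bound read on functions**: `γ‖A‖² ≤ ⟪A, TA⟫` for every `A` ⟹ `γ·(v·v) ≤ v·(onFun T)v` for every `v`.
[cite: Balaban1984PropagatorsII, (2.22) p.226, dictionary] -/
theorem onFun_coer_of_inner (T : EuclideanSpace ℝ X →ₗ[ℝ] EuclideanSpace ℝ X) {γ : ℝ}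
    (hT : ∀ A : EuclideanSpace ℝ X, γ * ‖A‖ ^ 2 ≤ ⟪A, T A⟫_ℝ) (v : X → ℝ) : γ * (v ⬝ᵥ v) ≤ v ⬝ᵥ onFun T v := by
  rw [dotProduct_onFun, dotProduct_self_eq_norm_sq]
  exact hT _

end Lift

/-! ## §2 At def-Y's letters: `Δ_a(1)` coercive with C5's explicit constant on one-level members, and on the pure-gauge orbit -/

section DefY

open scoped Matrix.Norms.L2Operator

variable {d ℓ : ℕ} {hd : 1 ≤ d + 1} {hL : Odd (ℓ + 1) ∧ 1 < ℓ + 1} {b₀ b₁ : ℝ} {N : ℕ}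
variable (i : KIdx d ℓ hd hL b₀ b₁)

/-- **THE INDEX'S WEIGHT BAND GIVES A UNIFORM FLOOR**: `0 ≤ b₀ → b₀·c_f² ≤ w(j)` for every index bond `j` of `Δ_a` (from `KIdx.hwb`:
`w(j)∕(c_f∕L^{n(j)})² ≥ b₀·(L^{n(j)})^{d+1}`, and `(L^{n})^{d+1} ≥ (L^{n})²` as `d + 1 ≥ 2`). [cite: Balaban1984PropagatorsII, (2.16) p.225 (the weights a_j(L^jη)^…), bookkeeping] -/
theorem w_lower_of_globalBand (hd2 : 2 ≤ d + 1) (hb₀ : 0 ≤ b₀) (j : BondIdx (domT i.hN i.D i.hk)) : b₀ * i.cf ^ 2 ≤ i.w j := by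
  obtain ⟨h1, -⟩ := i.hwb j
  obtain ⟨Ln, hLn⟩ : ∃ Ln : ℝ, Ln = ((ℓ + 1 : ℕ) : ℝ) ^ (j.1.1 : ℕ) := ⟨_, rfl⟩
  rw [← hLn] at h1
  have hLn1 : 1 ≤ Ln := by
    rw [hLn]; exact one_le_pow₀ (by exact_mod_cast Nat.succ_le_succ (Nat.zero_le ℓ))
  have hLn0 : 0 < Ln := lt_of_lt_of_le one_pos hLn1
  have hq : 0 < (i.cf / Ln) ^ 2 := sq_pos_iff.mpr (div_ne_zero i.hcf hLn0.ne')
  have h2 : b₀ * Ln ^ (d + 1) * (i.cf / Ln) ^ 2 ≤ i.w j := (le_div_iff₀ hq).1 h1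
  obtain ⟨d', rfl⟩ : ∃ d', d = d' + 1 := ⟨d - 1, by omega⟩
  calc b₀ * i.cf ^ 2 ≤ b₀ * i.cf ^ 2 * Ln ^ d' :=
        le_mul_of_one_le_right (mul_nonneg hb₀ (sq_nonneg _)) (one_le_pow₀ hLn1)
    _ = b₀ * Ln ^ (d' + 1 + 1) * (i.cf / Ln) ^ 2 := by
        field_simp
        ring
    _ ≤ i.w j := h2

/-- ★★★ **«Δ_a IS BOUNDED FROM BELOW BY A POSITIVE CONSTANT» AT def-Y's LETTERS, `U = 1`, ONE-LEVEL MEMBERS, EXPLICIT AND VOLUME-FREE**: for an index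
`i` whose torus family has constant level (`∀ x, i.D.lev x = i.k`), `d + 1 ≥ 2`, and a weight floor `0 < w₀ ≤ i.w`:
**`γ · ⟨Ψ, Ψ⟩₁ ≤ ⟨Ψ, Δ_a(1)Ψ⟩₁` for EVERY `Ψ : FBondY i → M_N(ℂ)`**, `Δ_a(1) = deltaAY i parSymY parBY (GpY i parSymY) 1`, with dag-n10-c's constant
`γ = (2∕κ + (4∕π)(1 + 4(d+1)c_f²∕κ))⁻¹`, `κ = (1∕(12(d+1)²))·((Lᵏ)^{d+2})⁻¹·min(c_f², w₀∕(Lᵏ)^{d−1})`, `π = 8c_f²∕(Lᵏ)²` (`L = ℓ+1`, `k = i.k`) — ROAD «C» C5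
(`deltaAE_coercive_domT_of_lev_eq`) ∘ def-Y's «coincides with Δ_a in (2.19) if U = 1» (`deltaAY_one`) ∘ §1 (`liftEndY_coer`, `onFun_coer_of_inner`).
[cite: Balaban1985BackgroundPropagators, (3.26) p.395 + p.395 («if U = 1»); Balaban1984PropagatorsII, (2.19) p.226 + p.226 («bounded from below»); Balaban1984PropagatorsI, Prop. 1.1 (1.90) p.33] -/
theorem coer_trIP_deltaAY_parSymY_one_of_lev_eq (hd2 : 2 ≤ d + 1) (hlev : ∀ x, i.D.lev x = i.k) {w₀ : ℝ} (hw₀ : 0 < w₀)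
    (hw : ∀ j, w₀ ≤ i.w j) (Ψ : FBondY i → Matrix (Fin N) (Fin N) ℂ) :
    (2 / (1 / (12 * (((PV d ℓ i.m i.K hd hL).d : ℕ) : ℝ) ^ 2) * ((((PV d ℓ i.m i.K hd hL).L : ℝ) ^ i.k) ^ ((PV d ℓ i.m i.K hd hL).d + 1))⁻¹ *
          min (i.cf ^ 2) (w₀ / (((PV d ℓ i.m i.K hd hL).L : ℝ) ^ i.k) ^ ((PV d ℓ i.m i.K hd hL).d - 2))) +
        4 / (8 * i.cf ^ 2 / (((PV d ℓ i.m i.K hd hL).L : ℝ) ^ i.k) ^ 2) *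
          (1 + 4 * (PV d ℓ i.m i.K hd hL).d * i.cf ^ 2 / (1 / (12 * (((PV d ℓ i.m i.K hd hL).d : ℕ) : ℝ) ^ 2) *
            ((((PV d ℓ i.m i.K hd hL).L : ℝ) ^ i.k) ^ ((PV d ℓ i.m i.K hd hL).d + 1))⁻¹ *
              min (i.cf ^ 2) (w₀ / (((PV d ℓ i.m i.K hd hL).L : ℝ) ^ i.k) ^ ((PV d ℓ i.m i.K hd hL).d - 2)))))⁻¹ *
        trIP (fun _ => (1 : ℝ)) Ψ Ψ ≤
      trIP (fun _ => (1 : ℝ)) Ψ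
        (deltaAY i (parSymY i) (parBY i) (GpY i (parSymY i)) (fun _ _ => 1 : CfgY (Matrix (Fin N) (Fin N) ℂ) i) Ψ) := by
  have hparS : ∀ z w, parSymY (𝔸 := Matrix (Fin N) (Fin N) ℂ) i (fun _ _ => 1) z w = 1 := fun z w => parSymY_one i z w
  have hparB : ∀ s s', parBY (𝔸 := Matrix (Fin N) (Fin N) ℂ) i (fun _ _ => 1) s s' = 1 := fun s s' => parBY_one i s s'
  have hGp : ∀ (f : SiteY i → ℝ) (E : Matrix (Fin N) (Fin N) ℂ),
      GpY i (parSymY i) (fun _ _ => 1) (liftY f E) = liftY ((toKT i).G *ᵥ f) E := fun f E => GpY_one_liftY i (parSymY i) hparS f E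
  rw [deltaAY_one i hparS hparB hGp]
  exact liftEndY_coer _
    (fun v => onFun_coer_of_inner _ (fun A => deltaAE_coercive_domT_of_lev_eq hd2 i.hN i.D i.hk hlev i.hcf hw₀ hw A) v) Ψ

/-- the constant is positive (n10-c's `deltaAE_coercive_const_pos` at the index's letters). [cite: Balaban1984PropagatorsII, (2.19) p.226; folklore] -/
theorem coer_const_pos (hd2 : 2 ≤ d + 1) {w₀ : ℝ} (hw₀ : 0 < w₀) :
    0 < (2 / (1 / (12 * (((PV d ℓ i.m i.K hd hL).d : ℕ) : ℝ) ^ 2) * ((((PV d ℓ i.m i.K hd hL).L : ℝ) ^ i.k) ^ ((PV d ℓ i.m i.K hd hL).d + 1))⁻¹ *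
          min (i.cf ^ 2) (w₀ / (((PV d ℓ i.m i.K hd hL).L : ℝ) ^ i.k) ^ ((PV d ℓ i.m i.K hd hL).d - 2))) +
        4 / (8 * i.cf ^ 2 / (((PV d ℓ i.m i.K hd hL).L : ℝ) ^ i.k) ^ 2) *
          (1 + 4 * (PV d ℓ i.m i.K hd hL).d * i.cf ^ 2 / (1 / (12 * (((PV d ℓ i.m i.K hd hL).d : ℕ) : ℝ) ^ 2) *
            ((((PV d ℓ i.m i.K hd hL).L : ℝ) ^ i.k) ^ ((PV d ℓ i.m i.K hd hL).d + 1))⁻¹ *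
              min (i.cf ^ 2) (w₀ / (((PV d ℓ i.m i.K hd hL).L : ℝ) ^ i.k) ^ ((PV d ℓ i.m i.K hd hL).d - 2)))))⁻¹ :=
  deltaAE_coercive_const_pos (P := PV d ℓ i.m i.K hd hL) hd2 i.k i.hcf hw₀

/-- ★★ **`∃ γ > 0` WITH `γ` PINNED TO THE EXPLICIT CONSTANT** (the quantitative form of `exists_coer_deltaAY_parSymY_one` on one-level members).
[cite: Balaban1985BackgroundPropagators, p.395 («if U = 1»); Balaban1984PropagatorsII, p.226; Balaban1984PropagatorsI, Prop. 1.1 (1.90) p.33] -/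
theorem exists_coer_trIP_deltaAY_parSymY_one_of_lev_eq (hd2 : 2 ≤ d + 1) (hlev : ∀ x, i.D.lev x = i.k) {w₀ : ℝ} (hw₀ : 0 < w₀)
    (hw : ∀ j, w₀ ≤ i.w j) :
    ∃ γ : ℝ, 0 < γ ∧
      γ = (2 / (1 / (12 * (((PV d ℓ i.m i.K hd hL).d : ℕ) : ℝ) ^ 2) * ((((PV d ℓ i.m i.K hd hL).L : ℝ) ^ i.k) ^ ((PV d ℓ i.m i.K hd hL).d + 1))⁻¹ *
          min (i.cf ^ 2) (w₀ / (((PV d ℓ i.m i.K hd hL).L : ℝ) ^ i.k) ^ ((PV d ℓ i.m i.K hd hL).d - 2))) +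
        4 / (8 * i.cf ^ 2 / (((PV d ℓ i.m i.K hd hL).L : ℝ) ^ i.k) ^ 2) *
          (1 + 4 * (PV d ℓ i.m i.K hd hL).d * i.cf ^ 2 / (1 / (12 * (((PV d ℓ i.m i.K hd hL).d : ℕ) : ℝ) ^ 2) *
            ((((PV d ℓ i.m i.K hd hL).L : ℝ) ^ i.k) ^ ((PV d ℓ i.m i.K hd hL).d + 1))⁻¹ *
              min (i.cf ^ 2) (w₀ / (((PV d ℓ i.m i.K hd hL).L : ℝ) ^ i.k) ^ ((PV d ℓ i.m i.K hd hL).d - 2)))))⁻¹ ∧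
      ∀ Ψ : FBondY i → Matrix (Fin N) (Fin N) ℂ,
        γ * trIP (fun _ => (1 : ℝ)) Ψ Ψ ≤
          trIP (fun _ => (1 : ℝ)) Ψ (deltaAY i (parSymY i) (parBY i) (GpY i (parSymY i)) (fun _ _ => 1 : CfgY (Matrix (Fin N) (Fin N) ℂ) i) Ψ) :=
  ⟨_, coer_const_pos i hd2 hw₀, rfl, coer_trIP_deltaAY_parSymY_one_of_lev_eq i hd2 hlev hw₀ hw⟩

/-- ★★ **THE SAME CONSTANT ON THE WHOLE GAUGE ORBIT OF `1`**: for `u` unitary-valued, `γ · ⟨Ψ, Ψ⟩₁ ≤ ⟨Ψ, Δ_a(1^u)Ψ⟩₁` for every `Ψ` — (3.34)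
(`deltaAY_cov` at def-Y's lawful letters: `Δ_a(U^u)R(u) = R(u)Δ_a(U)`) read quantitatively (`coer_of_intw_conjY`: `R(u)` is an onto isometry of `⟨·,·⟩₁`).
[cite: Balaban1985BackgroundPropagators, (3.34) p.396 + (3.26) p.395; Balaban1984PropagatorsII, p.226; Balaban1984PropagatorsI, Prop. 1.1 (1.90) p.33] -/
theorem coer_trIP_deltaAY_parSymY_pureGauge_of_lev_eq (hd2 : 2 ≤ d + 1) (hlev : ∀ x, i.D.lev x = i.k) {w₀ : ℝ} (hw₀ : 0 < w₀)
    (hw : ∀ j, w₀ ≤ i.w j) (u : GaugeY (Matrix (Fin N) (Fin N) ℂ) i)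
    (hu : ∀ x, ((u x : (Matrix (Fin N) (Fin N) ℂ)ˣ) : Matrix (Fin N) (Fin N) ℂ) ∈ unitary _) (Ψ : FBondY i → Matrix (Fin N) (Fin N) ℂ) :
    (2 / (1 / (12 * (((PV d ℓ i.m i.K hd hL).d : ℕ) : ℝ) ^ 2) * ((((PV d ℓ i.m i.K hd hL).L : ℝ) ^ i.k) ^ ((PV d ℓ i.m i.K hd hL).d + 1))⁻¹ *
          min (i.cf ^ 2) (w₀ / (((PV d ℓ i.m i.K hd hL).L : ℝ) ^ i.k) ^ ((PV d ℓ i.m i.K hd hL).d - 2))) +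
        4 / (8 * i.cf ^ 2 / (((PV d ℓ i.m i.K hd hL).L : ℝ) ^ i.k) ^ 2) *
          (1 + 4 * (PV d ℓ i.m i.K hd hL).d * i.cf ^ 2 / (1 / (12 * (((PV d ℓ i.m i.K hd hL).d : ℕ) : ℝ) ^ 2) *
            ((((PV d ℓ i.m i.K hd hL).L : ℝ) ^ i.k) ^ ((PV d ℓ i.m i.K hd hL).d + 1))⁻¹ *
              min (i.cf ^ 2) (w₀ / (((PV d ℓ i.m i.K hd hL).L : ℝ) ^ i.k) ^ ((PV d ℓ i.m i.K hd hL).d - 2)))))⁻¹ *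
        trIP (fun _ => (1 : ℝ)) Ψ Ψ ≤
      trIP (fun _ => (1 : ℝ)) Ψ
        (deltaAY i (parSymY i) (parBY i) (GpY i (parSymY i)) (gaugeY i u (fun _ _ => 1 : CfgY (Matrix (Fin N) (Fin N) ℂ) i)) Ψ) :=
  coer_of_intw_conjY (gBondY_mem_unitary i hu)
    (deltaAY_cov (g := u) (U := (fun _ _ => 1 : CfgY (Matrix (Fin N) (Fin N) ℂ) i)) (parSymY_isGaugeLawS i) (parBY_isGaugeLawB i)
      (GpY_isCovSiteOpY (parSymY_isGaugeLawS i)))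
    (coer_trIP_deltaAY_parSymY_one_of_lev_eq i hd2 hlev hw₀ hw) Ψ

/-- ★★ **WEIGHT FLOOR FROM THE BAND**: when `0 < b₀` the index's own weight band supplies `w₀ := b₀·c_f²`, so on one-level members `Δ_a(1)` is coercive with
C5's constant at `(c_f, k, b₀·c_f²)` and NO further weight hypothesis. [cite: Balaban1985BackgroundPropagators, p.395 («if U = 1»); Balaban1984PropagatorsII, (2.16) p.225 + p.226; Balaban1984PropagatorsI, Prop. 1.1 (1.90) p.33] -/
theorem coer_trIP_deltaAY_parSymY_one_of_lev_eq_band (hd2 : 2 ≤ d + 1) (hb₀ : 0 < b₀) (hlev : ∀ x, i.D.lev x = i.k)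
    (Ψ : FBondY i → Matrix (Fin N) (Fin N) ℂ) :
    (2 / (1 / (12 * (((PV d ℓ i.m i.K hd hL).d : ℕ) : ℝ) ^ 2) * ((((PV d ℓ i.m i.K hd hL).L : ℝ) ^ i.k) ^ ((PV d ℓ i.m i.K hd hL).d + 1))⁻¹ *
          min (i.cf ^ 2) (b₀ * i.cf ^ 2 / (((PV d ℓ i.m i.K hd hL).L : ℝ) ^ i.k) ^ ((PV d ℓ i.m i.K hd hL).d - 2))) +
        4 / (8 * i.cf ^ 2 / (((PV d ℓ i.m i.K hd hL).L : ℝ) ^ i.k) ^ 2) *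
          (1 + 4 * (PV d ℓ i.m i.K hd hL).d * i.cf ^ 2 / (1 / (12 * (((PV d ℓ i.m i.K hd hL).d : ℕ) : ℝ) ^ 2) *
            ((((PV d ℓ i.m i.K hd hL).L : ℝ) ^ i.k) ^ ((PV d ℓ i.m i.K hd hL).d + 1))⁻¹ *
              min (i.cf ^ 2) (b₀ * i.cf ^ 2 / (((PV d ℓ i.m i.K hd hL).L : ℝ) ^ i.k) ^ ((PV d ℓ i.m i.K hd hL).d - 2)))))⁻¹ *
        trIP (fun _ => (1 : ℝ)) Ψ Ψ ≤
      trIP (fun _ => (1 : ℝ)) Ψ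
        (deltaAY i (parSymY i) (parBY i) (GpY i (parSymY i)) (fun _ _ => 1 : CfgY (Matrix (Fin N) (Fin N) ℂ) i) Ψ) :=
  coer_trIP_deltaAY_parSymY_one_of_lev_eq i hd2 hlev (mul_pos hb₀ (sq_pos_iff.mpr i.hcf))
    (fun j => w_lower_of_globalBand i hd2 hb₀.le j) Ψ

end DefY

end

end Literature.MathematicalPhysics.QuantumFieldTheory.Balaban1983to89.B9DeltaAOneCoerciveOneLevelY
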